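import Literature.Computability.Cryptography.RegevSamplerClassical
import HarnessLib

/-!
# Regev 2009, Lemma 3.14 in machine form: the query the sampler's stage hands to the `CVP` subroutine

Topic `Computability/Cryptography` (family `pqc`), grouping namespace `Regev2009.SamplerQuery`; sequel of
`RegevSamplerClassical.lean` (`kappa_spec`: the classical stage `O·C_X·O·C_S·C_Y` on a prepared label —
zone `S` ends up holding the residue word, the input zone `U` is untouched) and `RegevSamplerWords.lean`
(`wordS_points`: the residue word of a grid point is the `CVP` query TABLE `table ℓ_R (sNat I R x̃)`),
towards the query-format hypotheses of the substitution bound (`RegevSamplerSubstLaw.law_bound_sampler`: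
every box point's query must be the `CVP` query STRING `CVPOracle.query I r k y c` of in-range data `c`
with a full-length answer table). Regev 2009 (J. ACM 56, art. 34; arXiv:2401.03703, Lemma 3.14 p. 20 with
Lemma 3.3 p. 15): the oracle is asked for the closest vector to the point described by `x mod P(L)` —
in the tree's string model, the doubled classical prefix `⟨⟨stage input⟩, ⟨ℓ_R, b_c⟩⟩`, the separator,
then the residue table (`CVPOracle.query_eq_append`).

* `ofFn_qry_kappa` — on a prepared label (the hypotheses of `kappa_spec`), the query read off the FINAL
  label is `F_q ++ wordS(x)`: the query prefix placed in zone `U` followed by the residue word;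
* `prefix_append_wordS_eq_query` — with `F_q` THE doubled prefix of `(I, r, k, y, ℓ_R, b_c)` and the point
  register holding the grid word of `Y`, that string IS `CVPOracle.query I r k y (sNat I R x̃, ℓ_R, b_c)`;
* `inRange_sNat` (`R ≤ 2^{ℓ_R}` ⇒ the data are in range), `length_answerTable_sNat` (the answer table has
  the answer zone's length `n·b_c`).

Everything is proved; no definition, no named fact is introduced.

## References

* O. Regev, *On lattices, learning with errors, random linear codes, and cryptography*, J. ACM 56
  (2009), art. 34; author's version arXiv:2401.03703: Lemma 3.14 (proof, p. 20), Lemma 3.3 (proof,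
  p. 15) [Regev2009].
* S. Arora, B. Barak, *Computational Complexity: A Modern Approach*, CUP 2009, §0.1 (pairing of
  strings) [AroraBarak2009].
-/

noncomputable section

namespace Literature.Computability.Cryptography

namespace Regev2009

namespace SamplerQuery

open Literature.Algebra.EuclideanLattices Literature.Computability.Complexity Literature.Computability.QuantumComplexity
  SamplerClassical SamplerWords SamplerWordFns SamplerArith SamplerFormats _root_.Computability

variable {W n : ℕ} {Λ : SamplerClassical.Layout W n} (hΛ : Λ.OK) (hF : Fits Λ)

include hΛ hF in
/-- **The query read off the final label of the ideal run is `F_q ++ wordS(x)`.** Hypotheses as in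
`SamplerClassical.kappa_spec`. [cite: Regev2009, Lemma 3.14 (proof)] -/
theorem ofFn_qry_kappa (f : (Fin Λ.kq → Bool) → (Fin (n * Λ.bc) → Bool)) (Pa : PAll) (xb Fq pad : List Bool)
    (hxb : xb.length = n * Λ.ℓ) (hFq : Fq.length = Λ.Lq) (huz : (zoneOf Fq Pa pad).length = Λ.L)
    (hY : (wordY Pa.1.1 n Λ.ℓ Λ.ℓY xb).length = n * Λ.ℓY) (hS : (wordS Pa.1.1 Pa.1.2 n Λ.ℓ Λ.ℓR xb).length = n * Λ.ℓR)
    (z : QReg W) (hzX : ∀ t, t < n * Λ.ℓ → z (Λ.fin t) = xb.getD t false)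
    (hzU : ∀ t, t < Λ.L → z (Λ.fin (Λ.oU + t)) = (zoneOf Fq Pa pad).getD t false)
    (hzR : ∀ t, Λ.oY ≤ t → t < Λ.T → z (Λ.fin t) = false) (hzw : ∀ w : Fin W, Λ.base ≤ (w : ℕ) → z w = false) :
    List.ofFn (qry Λ (kappa Λ f z)) = Fq ++ wordS Pa.1.1 Pa.1.2 n Λ.ℓ Λ.ℓR xb := by
  obtain ⟨-, -, h3, -, h5⟩ := kappa_spec hΛ hF f Pa xb Fq pad hxb hFq huz hY hS z hzX hzU hzR hzw
  have hT := Λ.T_eq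
  have hkq : Λ.kq = Λ.Lq + n * Λ.ℓR := rfl
  have hoU : Λ.oU = n * Λ.ℓ := rfl
  have hoY : Λ.oY = Λ.oU + Λ.L := rfl
  have hLq := hΛ.Lq_le
  refine List.ext_getElem (by rw [List.length_ofFn, List.length_append, hFq, hS, hkq]) fun i h₁ h₂ => ?_
  rw [List.length_ofFn] at h₁
  rw [List.getElem_ofFn]
  show (if ((⟨i, h₁⟩ : Fin Λ.kq) : ℕ) < Λ.Lq then kappa Λ f z (Λ.fin (Λ.oU + i)) else kappa Λ f z (Λ.fin (Λ.oS + (i - Λ.Lq)))) = _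
  by_cases hi : i < Λ.Lq
  · rw [if_pos hi, List.getElem_append_left (by rw [hFq]; exact hi)]
    have hne₁ : ∀ t, t < n * Λ.ℓ → Λ.fin (Λ.oU + i) ≠ Λ.fin t := fun t ht h =>
      absurd (Layout.fin_inj hΛ (by omega) (by omega) h) (by omega)
    have hne₂ : ∀ t, Λ.oY ≤ t → t < Λ.T → Λ.fin (Λ.oU + i) ≠ Λ.fin t := fun t ht htT h =>
      absurd (Layout.fin_inj hΛ (by omega) htT h) (by omega)
    rw [h5 _ hne₁ hne₂, hzU i (by omega), zoneOf, getD_append_of, if_pos (by rw [hFq]; exact hi),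
      List.getD_eq_getElem _ _ (by rw [hFq]; exact hi)]
  · rw [if_neg hi, List.getElem_append_right (by rw [hFq]; omega), h3 _ (by omega),
      List.getD_eq_getElem _ _ (by rw [hS]; omega)]
    simp only [hFq]

/-- **The prefix followed by the residue word of a grid point is the `CVP` query string** of the data
`(sNat I R x̃, ℓ_R, b_c)`. [cite: Regev2009, Lemma 3.14 (proof), Lemma 3.3 (proof)] [cite: AroraBarak2009, §0.1] -/
theorem prefix_append_wordS_eq_query (I : LatticeInstance) (R : ℕ) (hR : 1 ≤ R) {ℓ : ℕ} (ℓR bc : ℕ)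
    (Y : Fin I.n → Fin ℓ → Bool) (r : ℚ) (k : ℕ) (y : List Bool) :
    boolPair (boolPair (stageInput (GapSVPInstance.encode (I, r)) (k + 1) y) (boolPair (encodeNat ℓR) (encodeNat bc))) [] ++
        wordS (parOf I) R I.n ℓ ℓR (pointsWord Y) =
      CVPOracle.query I r k y (sNat I R (gridVec I Y), ℓR, bc) := by
  rw [wordS_points I R hR, CVPOracle.query_eq_append, CVPOracle.fstF_query]

/-- The data of a grid point are in range once `R ≤ 2^{ℓ_R}`. [cite: Regev2009, Lemma 3.14 (proof)] -/
theorem inRange_sNat (I : LatticeInstance) {R ℓR : ℕ} (hR : 0 < R) (hRℓ : R ≤ 2 ^ ℓR) (bc : ℕ) (v : Fin I.n → ℤ) :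
    CVPOracle.InRange (n := I.n) (sNat I R v, ℓR, bc) :=
  fun j => (sNat_lt hR v j).trans_le hRℓ

/-- The answer table of the data of a grid point has the answer zone's length. [folklore] -/
theorem length_answerTable_sNat (I : LatticeInstance) (R ℓR bc : ℕ) (v : Fin I.n → ℤ) :
    (CVPOracle.answerTable I (sNat I R v, ℓR, bc)).length = I.n * bc :=
  CVPOracle.length_answerTable I _

end SamplerQuery

end Regev2009

end Literature.Computability.Cryptography

end
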